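import Literature.Geometry.Riemannian.PerelmanEntropyFormulaManifold
import Literature.Geometry.Riemannian.FamilyLaplacianRegularity
import Literature.Geometry.Lorentzian.CoordFisherDissipation
import HarnessLib

/-!
# `∂ₜ Δ_g f = Δ_g ∂ₜ f` for a fixed metric: the Laplace–Beltrami operator commutes with the
# time derivative of a smooth space-time function

Topping 2006, Prop. 2.3.10 computes the evolution of the Laplacian along a smooth family of
metrics, `∂ₜ Δ f = Δ ḟ − ⟨h, Hess f⟩ − Df(tr_g Π)` with `h = ∂ₜ g`, `Π = ∂ₜ Γ`; the tree has this in
coordinates (`MetricCoord.IsMetricFamilyOn.hasDerivWithinAt_lapAt`). For a STATIC metric (`h = 0`,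
`Π = 0`) it says that the time derivative of `Δ_g (f t)` is `Δ_g (∂ₜ f)` — the commutation of mixed
partial derivatives with the spatial operator `Δ_g` — which this file transports to the manifold:

* `MetricCoord.varChrAt_const` — the variation of the Christoffel map of a constant family
  vanishes;
* **`hasDerivWithinAt_laplaceBeltrami_static`** — for `g : PseudoRiemannianMetric` (any model with
  boundaryless finite-dimensional model space), `S ⊆ ℝ` with unique derivatives and
  `S ⊆ closure (interior S)` (e.g. an interval), `f : ℝ → M → ℝ` `C^∞` on `M × S`, `t ∈ S` and a
  `C²` function `f'` with `∂ₜ f(·, x)|_t = f' x` (derivative within `S`) for all `x`: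
  `s ↦ Δ_g (f s) x` has derivative `Δ_g f' x` within `S` at `t`, at every `x`.

Read in the chart at `x` (`chartRep`, `lapAt_chartRep_eq`, `contDiffOn_chart_of_contMDiffOn_source_prod`)
this is the coordinate statement for the constant family of chart components
(`IsMetricOn.isMetricFamilyOn_const`, `tDeriv_const`, `varChrAt_const`). Purpose: the energy
identities of the heat flow of a fixed metric (`d/dt ∫ (Δu)² = 2 ∫ Δu ΔΔu`, …) in the smoothing
step of Colding's volume sphere theorem (`Colding1996_volume_ghClose`). Everything here is proved;
no definitions, no named facts (D-0026).

## References

* P. Topping, *Lectures on the Ricci flow* (2006), Prop. 2.3.10. [Topping2006]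
* B. O'Neill, *Semi-Riemannian geometry* (1983), Ch. 3, Prop. 3.59 (naturality of `Δ` under local
  isometries). [ONeill1983]
-/

noncomputable section

open Set Filter Function
open scoped Topology ContDiff Manifold

/-! ### The coordinate statement for a constant family -/

namespace Literature.Geometry.Lorentzian

namespace MetricCoord

variable {E : Type*} [NormedAddCommGroup E] [NormedSpace ℝ E] [FiniteDimensional ℝ E]
  [CompleteSpace E]

omit [FiniteDimensional ℝ E] in
/-- The variation of the Christoffel map of a constant family vanishes (`Π = ∂ₜΓ = 0` when
`∂ₜ G = 0`). [cite: Topping2006, Prop. 2.3.1] -/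
theorem varChrAt_const (G : E → E →L[ℝ] E →L[ℝ] ℝ) (S : Set ℝ) (t : ℝ) (x : E) :
    varChrAt (fun _ : ℝ ↦ G) S t x = 0 := by
  have h0 : tDeriv (fun _ : ℝ ↦ G) S t = fun _ ↦ 0 := funext fun y ↦ tDeriv_const G S t y
  have h0' : fderiv ℝ (tDeriv (fun _ : ℝ ↦ G) S t) x = 0 := by
    rw [h0]; exact fderiv_const_apply _
  have hk : ∀ X Y : E, koszulOp (fderiv ℝ (tDeriv (fun _ : ℝ ↦ G) S t) x) X Y = 0 := by
    intro X Y
    ext W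
    rw [koszulOp_apply, h0']
    simp
  ext Y Z
  rw [varChrAt_apply, hk, tDeriv_const]
  simp

/-- **`∂ₜ Δ f = Δ ḟ` in coordinates for a static metric** (`hasDerivWithinAt_lapAt` with
`∂G/∂t = 0`, `∂Γ/∂t = 0`). [cite: Topping2006, Prop. 2.3.10] -/
theorem IsMetricOn.hasDerivWithinAt_lapAt_static {G : E → E →L[ℝ] E →L[ℝ] ℝ} {V : Set E}
    {S : Set ℝ} {x : E} {t : ℝ} {f : ℝ → E → ℝ} (hG : IsMetricOn G V) (hS : UniqueDiffOn ℝ S)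
    (hS' : S ⊆ closure (interior S))
    (hf : ContDiffOn ℝ ∞ (fun p : E × ℝ ↦ f p.2 p.1) (V ×ˢ S)) (hx : x ∈ V) (ht : t ∈ S) :
    HasDerivWithinAt (fun s ↦ lapAt G (f s) x) (lapAt G (tDerivFun f S t) x) S t := by
  have h := (hG.isMetricFamilyOn_const hS hS').hasDerivWithinAt_lapAt (Module.finBasis ℝ E) hf hx ht
  simp only [tDeriv_const, varChrAt_const, _root_.zero_apply, smul_zero, Finset.sum_const_zero,
    map_zero, sub_zero, pairAt_apply, ContinuousLinearMap.comp_zero,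
    ContinuousLinearMap.zero_comp] at h
  exact h

end MetricCoord

end Literature.Geometry.Lorentzian

/-! ### On the manifold -/

namespace Literature.Geometry.Riemannian

open Lorentzian Lorentzian.PseudoRiemannianMetric

variable {E : Type*} [NormedAddCommGroup E] [NormedSpace ℝ E] [FiniteDimensional ℝ E]
  [CompleteSpace E] {H : Type*} [TopologicalSpace H] {I : ModelWithCorners ℝ E H} [I.Boundaryless]
  {M : Type*} [TopologicalSpace M] [ChartedSpace H M] [IsManifold I ∞ M]

/-- **`∂ₜ Δ_g (f t) = Δ_g (∂ₜ f)` for a fixed metric** (Topping 2006, Prop. 2.3.10 with `∂ₜg = 0`;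
the commutation of the time derivative with the spatial operator `Δ_g` for a space-time smooth
function). Let `g` be a `C^∞` metric on a manifold with boundaryless finite-dimensional model,
`S ⊆ ℝ` a time set with unique derivatives and `S ⊆ closure (interior S)`, `f : ℝ → M → ℝ` `C^∞`
on `M × S`, `t ∈ S`, and `f' : M → ℝ` a `C²` function with `∂ₜ f(·, x)|_{t} = f' x` (derivative
within `S`) for every `x`. Then for every `x`,
`HasDerivWithinAt (s ↦ Δ_g (f s) x) (Δ_g f' x) S t`. [cite: Topping2006, Prop. 2.3.10]
[cite: ONeill1983, Ch. 3, Prop. 3.59] -/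
theorem hasDerivWithinAt_laplaceBeltrami_static
    (g : PseudoRiemannianMetric I ∞ E (TangentSpace I : M → Type _))
    {S : Set ℝ} (hS : UniqueDiffOn ℝ S) (hS' : S ⊆ closure (interior S))
    {f : ℝ → M → ℝ}
    (hf : ContMDiffOn (I.prod 𝓘(ℝ, ℝ)) 𝓘(ℝ, ℝ) ∞ (fun p : M × ℝ ↦ f p.2 p.1) (univ ×ˢ S))
    {t : ℝ} (ht : t ∈ S) {f' : M → ℝ} (hf' : ContMDiff I 𝓘(ℝ, ℝ) 2 f')
    (hder : ∀ z, HasDerivWithinAt (fun s ↦ f s z) (f' z) S t) (x : M) :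
    HasDerivWithinAt (fun s ↦ g.laplaceBeltrami (f s) x) (g.laplaceBeltrami f' x) S t := by
  have h2 : (2 : ℕ∞ω) ≤ ∞ := WithTop.coe_le_coe.mpr le_top
  have hVopen : IsOpen (extChartAt I x).target := isOpen_extChartAt_target x
  -- (1) the constant family of chart components of `g` at `x`
  set gf : ℝ → PseudoRiemannianMetric I ∞ E (TangentSpace I : M → Type _) := fun _ ↦ g with hgf
  set G₀ : E → E →L[ℝ] E →L[ℝ] ℝ := chartRep I gf x t with hG₀
  have hGconst : ∀ s, chartRep I gf x s = G₀ := fun s ↦ rfl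
  have hG : MetricCoord.IsMetricOn G₀ (extChartAt I x).target :=
    Lorentzian.OpensChart.isMetricOn_repr (val_chartPullback_eq_chartRep gf x t)
  -- (2) `f` read in the chart
  set fc : ℝ → E → ℝ := fun s y ↦ f s ((extChartAt I x).symm y) with hfc
  have hfc_smooth : ContDiffOn ℝ ∞ (fun q : E × ℝ ↦ fc q.2 q.1)
      ((extChartAt I x).target ×ˢ S) :=
    contDiffOn_chart_of_contMDiffOn_source_prod (k := (⊤ : ℕ∞)) (w := f) x
      (hf.mono (prod_mono (subset_univ _) Subset.rfl))
  have hfslice : ∀ s ∈ S, ContMDiff I 𝓘(ℝ, ℝ) ∞ (f s) := fun s hs ↦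
    contMDiff_slice_of_contMDiffOn hf hs
  have hfct : ∀ s ∈ S, ContDiffOn ℝ ∞ (fc s) (extChartAt I x).target := fun s hs ↦
    MetricCoord.contDiffOn_of_family hfc_smooth hs
  have hy₀ : extChartAt I x x ∈ (extChartAt I x).target := mem_extChartAt_target x
  set u₀ : chartTarget I x := ⟨extChartAt I x x, hy₀⟩ with hu₀
  have hΦ0 : chartInv I x u₀ = x := extChartAt_to_inv x
  have hurep : ∀ s, ∀ y : chartTarget I x, f s (chartInv I x y) = fc s y := fun s y ↦ rfl
  -- (3) the coordinate statement at `(φ x, t)`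
  have hcoord := hG.hasDerivWithinAt_lapAt_static hS hS' hfc_smooth hy₀ ht
  -- (4) transport of the function: `lapAt G₀ (fc s) (φ x) = Δ_g (f s) x` for `s ∈ S`
  have hfun : ∀ s ∈ S, MetricCoord.lapAt G₀ (fc s) (extChartAt I x x) = g.laplaceBeltrami (f s) x := by
    intro s hs
    have h1 := lapAt_chartRep_eq gf x s u₀ (hurep s) (((hfslice s hs) _).of_le h2)
      (((hfct s hs).contDiffAt (hVopen.mem_nhds hy₀)).of_le h2)
    rw [hΦ0] at h1
    exact h1
  -- (5) transport of the derivative: `lapAt G₀ (ḟc) (φ x) = Δ_g f' x`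
  have hrep' : ∀ y : chartTarget I x, f' (chartInv I x y) = MetricCoord.tDerivFun fc S t y := by
    intro y
    rw [MetricCoord.tDerivFun]
    exact ((hder _).derivWithin (hS t ht)).symm
  have hder' : MetricCoord.lapAt G₀ (MetricCoord.tDerivFun fc S t) (extChartAt I x x) =
      g.laplaceBeltrami f' x := by
    have hFc : ContDiffAt ℝ 2 (MetricCoord.tDerivFun fc S t) u₀ :=
      (((MetricCoord.contDiffOn_tDerivFun hVopen hS hfc_smooth ht).contDiffAt
        (hVopen.mem_nhds hy₀))).of_le h2
    have h1 := lapAt_chartRep_eq gf x t u₀ hrep' ((hf' _).of_le le_rfl) hFc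
    rw [hΦ0] at h1
    exact h1
  -- (6) conclusion
  rw [← hder']
  exact hcoord.congr_of_mem (fun s hs ↦ (hfun s hs).symm) ht

end Literature.Geometry.Riemannian

end
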